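import Literature.LinearAlgebra.Matrix.OstrowskiComparisonMatrix
import HarnessLib

/-!
# Componentwise and sparse verification bounds for linear systems: Yamamoto's theorem, the
# Ogita–Oishi–Ushiro refinement, and `‖A⁻¹‖_∞` for monotone and H-matrices (Ogita–Oishi 2009, §§4.2–5.1)

HONEST FRAMING (ENGINES group, engine `cap`, part CAP-2): shared numerical engines serving client
cells; rigour lives in the verifiers; every published number belongs to a client cell's ledger, not
to the engines group. This file is a record-only Literature anchor: every statement below is a
published theorem, typed and PROVED here (no `sorry`, no new axioms); it publishes no number.

SOURCE (held, read in the author version `paper:doi-10-1007-bf03186530`): T. Ogita and S. Oishi,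
*Fast verified solutions of linear systems*, Japan J. Indust. Appl. Math. 26 (2009) 169–190
[OgitaOishi2009]. The setting (p. 176): `A ∈ ℝⁿˣⁿ`, `b ∈ ℝⁿ`, an approximate solution `x̃` of
`Ax = b`, an approximate inverse ("preconditioner") `R` of `A`, `e = (1, …, 1)ᵀ`, `|·|` and `≤`
entrywise. Verbatim statements and what is typed:

* **Theorem 4.3 (Yamamoto [41])** (p. 177, "a linearized version of Yamamoto's theorem"): "Let
  `A ∈ ℝⁿˣⁿ`, `R ∈ ℝⁿˣⁿ`, `b ∈ ℝⁿ` and `x̃ ∈ ℝⁿ` be given. If `‖I − RA‖_p < 1` for any `p ∈ {1, 2, ∞}`,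
  then `A` is nonsingular and
  (4.4) `|A⁻¹b − x̃| ≤ |R(b − Ax̃)| + (‖R(b − Ax̃)‖_p / (1 − ‖I − RA‖_p)) |I − RA| e`."
  Typed for an ABSTRACT size functional `N` on vectors dominating every component (`‖vᵢ‖ ≤ N v`),
  subadditive, and contracted by `G := I − RA` (`N(Gv) ≤ g·N v`, `g < 1`) — every `p`-norm with
  `‖G‖_p ≤ g` is such an `N`, which is the printed hypothesis —: `isUnit_det_of_contraction` (`A` AND
  `R` nonsingular), `size_inv_mulVec_sub_le` (`N(A⁻¹b − x̃) ≤ N(R(b − Ax̃))/(1 − g)`, the norm bound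
  (3.2) of Oishi–Rump that (4.4) refines), `yamamoto` (= (4.4) with `‖·‖_p ↦ N`, `‖I − RA‖_p ↦ g`);
  the instances `yamamoto_linfty` (`p = ∞`: `N = ‖·‖_∞`, `g ≥ ‖I − RA‖_∞` in the `ℓ∞` operator norm)
  and `yamamoto_l1` (`p = 1`: `N v = Σ‖vᵢ‖`, `g ≥` every absolute column sum of `I − RA`).
* **Theorem 4.5 (Ogita–Oishi–Ushiro [21])** (p. 183): "Let `A ∈ ℝⁿˣⁿ`, `b ∈ ℝⁿ`, `x̃ ∈ ℝⁿ` and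
  `ỹ ∈ ℝⁿ` be given. Suppose `‖A⁻¹‖_p ≤ τ` for any `p ∈ {1, 2, ∞}`. Then
  (4.10) `|A⁻¹b − x̃| ≤ |ỹ| + τ‖b − A(x̃ + ỹ)‖_p e`."  Typed as `oou_componentwise` (abstract `N`
  with `N(A⁻¹v) ≤ τ·N v`; `A` nonsingular is part of "`‖A⁻¹‖_p ≤ τ`") and `oou_componentwise_linfty`.
* **Theorem 5.1 (Ogita–Oishi–Ushiro [20])** (p. 185): "Let `A ∈ ℝⁿˣⁿ` be monotone. For given
  `ỹ ∈ ℝⁿ`, define a residual vector `s` by `s := e − Aỹ`. If `‖s‖_∞ < 1`, then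
  (5.1) `‖A⁻¹‖_∞ ≤ ‖ỹ‖_∞ / (1 − ‖s‖_∞)`."  ("Monotone": Definition 2.1, p. 171, "`Av ≥ o` for
  `v ∈ ℝⁿ` implies `v ≥ o`"; Lemma 2.5: "`A` is monotone if and only if `A` is nonsingular with
  `A⁻¹ ≥ O`" — we take the latter as the hypothesis.)  Typed as `linfty_norm_inv_le_of_inv_nonneg`
  (with an upper bound `σ`, `‖s‖_∞ ≤ σ < 1`, in place of `‖s‖_∞`, as a certificate uses it), and for
  the M-matrix case (a Z-matrix with a positive vector `u`, `Au ≫ 0`, is monotone — the landed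
  `IsZMatrix.inv_nonneg_of_semipositive`) as `linfty_norm_inv_le_of_isZMatrix`.
* **Corollary 5.2** (p. 185): "Let `A ∈ ℝⁿˣⁿ` be an H-matrix. For given `z̃ ∈ ℝⁿ`, define a residual
  vector `t` by `t := e − 𝓜(A)z̃`. If `‖t‖_∞ < 1`, then (5.2) `‖A⁻¹‖_∞ ≤ ‖z̃‖_∞ / (1 − ‖t‖_∞`," proved
  "from (2.1) and Theorem 5.1", where (2.1) (p. 172) is `‖A⁻¹‖_∞ ≤ ‖𝓜(A)⁻¹‖_∞` ("From Lemma 2.7"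
  `|A⁻¹| ≤ 𝓜(A)⁻¹` — Ostrowski; the landed
  `Literature.LinearAlgebra.Matrix.linfty_norm_inv_le_comparisonInv`), the comparison matrix `𝓜(A)`
  (p. 183) has `|aᵢᵢ|` on the diagonal and `−|aᵢⱼ|` off it (the landed `comparisonMatrix`), and
  "H-matrix" (Definition 2.3: `𝓜(A)` is an M-matrix) is taken through Lemma 2.6, p. 171: "`A` is an
  H-matrix if and only if there exists a vector `v > o` such that `𝓜(A)v > o`." Typed as
  `linfty_norm_inv_le_of_comparison_residual` (hypothesis: such a `v`, named `u`), over any normed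
  field of entries; and the SELF-WITNESSING form `…_of_pos`: if moreover `z̃ ≫ 0` then
  `𝓜(A)z̃ = e − t ≥ (1 − σ)e ≫ 0`, so `z̃` itself is the vector of Lemma 2.6 (p. 185: "we can obtain a
  vector `v > o` which is expected to satisfy `𝓜(A)v > o`. Using the verified numerical computation,
  it is easy to check whether it is true").
* **§5, p. 184**: "For diagonally dominant matrices, we do not need to compute a full matrix `R`:
  Suppose `A` is strictly (row) diagonally dominant. Let `D := diag(a₁₁, …, aₙₙ)` and `Ã := A − D`.
  If setting `R := D⁻¹ = diag(a₁₁⁻¹, …, aₙₙ⁻¹)`, then we have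
  `‖I − RA‖_∞ = ‖I − D⁻¹A‖_∞ = ‖D⁻¹Ã‖_∞ < 1`, since `Σ_{j≠i} |aᵢⱼ| < |aᵢᵢ|` for all `i`."  Typed as
  `linfty_norm_one_sub_diagInv_mul_lt_one`, with the resulting instance of (4.4) `yamamoto_diagDominant`.

Original sources of the theorems Ogita–Oishi restate (cited by them as [41], [21], [20]; not held —
the held survey above is the locus we type from): T. Yamamoto, *Error bounds for approximate
solutions of systems of equations*, Japan J. Appl. Math. 1 (1984) 157–171 [Yamamoto1984];
T. Ogita, S. Oishi, Y. Ushiro, *Computation of sharp rigorous componentwise error bounds for the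
approximate solutions of systems of linear equations*, Reliable Computing 9 (2003) 229–239
[OgitaOishiUshiro2003]; T. Ogita, S. Oishi, Y. Ushiro, *Fast verification of solutions for sparse
monotone matrix equations*, Computing Suppl. 15 (2001) 175–187 [OgitaOishiUshiro2001].

RENDERING. Index type any `Fintype n`; entries in a normed field `K` (`ℝ` or `ℂ`; Theorem 5.1 needs
the order of `ℝ`); `‖M‖` for a matrix is Mathlib's `ℓ∞` OPERATOR NORM (max absolute row sum, scoped
instance `Matrix.Norms.Operator`, `Matrix.linfty_opNorm_def`), `‖v‖` for a vector the sup norm; `e` is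
the vector `1`; `|I − RA| e` is written as its `i`-th entry `Σⱼ ‖(1 − R * A) i j‖`. A client holding an
UPPER BOUND `g ≥ ‖I − RA‖` (resp. `σ ≥ ‖s‖_∞`, `τ ≥ ‖A⁻¹‖`) applies the theorems with that bound:
all statements are monotone in it.

WHY (engine relevance): these are the componentwise error bounds a `verifylss`-type dense solver
returns without interval iteration (Thm 4.3), the residual-iteration sharpening that only needs a
bound on `‖A⁻¹‖` (Thm 4.5), and the two sparse routes to such a bound that avoid an approximate
inverse (Thm 5.1 / Cor 5.2: one extra approximate solve `Ay = e` resp. `𝓜(A)z = e`). They complement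
the landed norm-wise bound `Literature.ComputerArithmetic.OishiRump2002.linfty_norm_inv_mulVec_sub_le`
(Oishi–Rump (4): `‖A⁻¹b − x̃‖_∞ ≤ ‖R(Ax̃ − b)‖_∞/(1 − α)`) and the interval-arithmetic statements of
`Literature.Analysis.ValidatedNumerics.IntervalLinearSystems` (Neumaier §4.2 (3), the norm bound for
interval data).

NOT TYPED: the Hansen–Bliek–Rohn–Ning–Kearfott enclosure (Theorem 4.6), Rump's interval iteration
with epsilon-inflation (Theorem 4.1 / Algorithm 4.2 — the Krawczyk statement is the landed
`Literature.Analysis.ValidatedNumerics.KrawczykOperator`), the floating-point evaluation of the bounds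
(directed rounding / (4.7)–(4.8), see `Literature.ComputerArithmetic.OishiRump2002`), `p = 2` as a
named instance (it is the abstract `N = ‖·‖₂` with `g ≥ ‖I − RA‖₂`), and §5.2 (positive definite
systems: `Literature.ComputerArithmetic.Rump2006.CholeskyPositiveDefinite`).
-/

namespace Literature.Analysis.Matrix.ComponentwiseVerification

open scoped _root_.Matrix _root_.Matrix.Norms.Operator
open Finset _root_.Matrix
open Literature.LinearAlgebra.Matrix
open Literature.LinearAlgebra.Matrix.BauerFike

variable {K : Type*} [NormedField K] {n : Type*} [Fintype n] [DecidableEq n]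

/-! ### Yamamoto's theorem (Ogita–Oishi Theorem 4.3) over an abstract size functional `N` -/

section Abstract

variable {A R : Matrix n n K} {N : (n → K) → ℝ} {g : ℝ}

omit [DecidableEq n] in
/-- an entry of `Mv` is bounded by the absolute row sum times any bound dominating the entries of `v`:
`‖(M v)ᵢ‖ ≤ (Σⱼ ‖Mᵢⱼ‖) · c` if `‖vⱼ‖ ≤ c` for all `j`. [cite: OgitaOishi2009, Theorem 4.3 (proof of (4.4))] -/
theorem norm_mulVec_apply_le_rowSum_mul (M : Matrix n n K) {v : n → K} {c : ℝ}
    (hv : ∀ j, ‖v j‖ ≤ c) (i : n) : ‖(M *ᵥ v) i‖ ≤ (∑ j, ‖M i j‖) * c := by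
  have hc : ∀ j, ‖M i j * v j‖ ≤ ‖M i j‖ * c := fun j => by
    rw [norm_mul]; exact mul_le_mul_of_nonneg_left (hv j) (norm_nonneg _)
  calc ‖(M *ᵥ v) i‖ = ‖∑ j, M i j * v j‖ := by simp only [Matrix.mulVec, dotProduct]
    _ ≤ ∑ j, ‖M i j * v j‖ := norm_sum_le _ _
    _ ≤ ∑ j, ‖M i j‖ * c := sum_le_sum fun j _ => hc j
    _ = (∑ j, ‖M i j‖) * c := by rw [Finset.sum_mul]

/-- THEOREM 4.3, nonsingularity: if a size functional `N` dominating every component is contracted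
by `I − RA` (`N((I − RA)v) ≤ g·N v` with `g < 1` — e.g. `‖I − RA‖_p ≤ g < 1` for `N = ‖·‖_p`), then
`A` is nonsingular, and so is `R`. [cite: OgitaOishi2009, Theorem 4.3] [cite: Yamamoto1984] -/
theorem isUnit_det_of_contraction (hN : ∀ v i, ‖v i‖ ≤ N v)
    (hG : ∀ v, N ((1 - R * A) *ᵥ v) ≤ g * N v) (hg : g < 1) : IsUnit A.det ∧ IsUnit R.det := by
  have hRA : IsUnit (R * A).det := by
    rw [← isUnit_iff_isUnit_det, ← mulVec_injective_iff_isUnit]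
    intro v w hvw
    have hfix : (1 - R * A) *ᵥ (v - w) = v - w := by
      rw [sub_mulVec, one_mulVec, mulVec_sub (R * A), hvw, sub_self, sub_zero]
    have hle : N (v - w) ≤ g * N (v - w) := by simpa only [hfix] using hG (v - w)
    have hN0 : N (v - w) ≤ 0 := by
      by_contra hpos
      have hpos' : 0 < N (v - w) := not_le.mp hpos
      nlinarith
    funext i
    have hi : ‖(v - w) i‖ ≤ 0 := (hN _ i).trans hN0
    exact sub_eq_zero.mp (norm_le_zero_iff.mp hi)
  rw [det_mul] at hRA
  exact ⟨(IsUnit.mul_iff.mp hRA).2, (IsUnit.mul_iff.mp hRA).1⟩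

/-- The error `d := A⁻¹b − x̃` satisfies the fixed-point identity `d = R(b − Ax̃) + (I − RA)d`
(`A` nonsingular). [cite: OgitaOishi2009, Theorem 4.3 (proof of (4.4))] -/
theorem inv_mulVec_sub_eq (hA : IsUnit A.det) (b xt : n → K) :
    A⁻¹ *ᵥ b - xt = R *ᵥ (b - A *ᵥ xt) + (1 - R * A) *ᵥ (A⁻¹ *ᵥ b - xt) := by
  have hAv : A *ᵥ (A⁻¹ *ᵥ b - xt) = b - A *ᵥ xt := by
    rw [mulVec_sub, mulVec_mulVec, mul_nonsing_inv A hA, one_mulVec]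
  rw [sub_mulVec, one_mulVec, ← mulVec_mulVec, hAv]
  abel

/-- THEOREM 4.3, norm part (= Oishi–Rump's (3.2)/(4) for the size functional `N`): with `N`
subadditive and contracted by `I − RA` with constant `g < 1`,
`N(A⁻¹b − x̃) ≤ N(R(b − Ax̃)) / (1 − g)`. [cite: OgitaOishi2009, Theorem 4.3 and Theorem 4.1] [cite: Yamamoto1984] -/
theorem size_inv_mulVec_sub_le (hN : ∀ v i, ‖v i‖ ≤ N v) (hadd : ∀ v w, N (v + w) ≤ N v + N w)
    (hG : ∀ v, N ((1 - R * A) *ᵥ v) ≤ g * N v) (hg : g < 1) (b xt : n → K) :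
    N (A⁻¹ *ᵥ b - xt) ≤ N (R *ᵥ (b - A *ᵥ xt)) / (1 - g) := by
  have hA := (isUnit_det_of_contraction hN hG hg).1
  set d := A⁻¹ *ᵥ b - xt with hd
  have h1 : N d ≤ N (R *ᵥ (b - A *ᵥ xt)) + g * N d :=
    calc N d = N (R *ᵥ (b - A *ᵥ xt) + (1 - R * A) *ᵥ d) := by rw [← inv_mulVec_sub_eq hA]
      _ ≤ N (R *ᵥ (b - A *ᵥ xt)) + N ((1 - R * A) *ᵥ d) := hadd _ _
      _ ≤ N (R *ᵥ (b - A *ᵥ xt)) + g * N d := by gcongr; exact hG d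
  rw [le_div_iff₀ (sub_pos.mpr hg)]
  nlinarith

/-- **THEOREM 4.3 (Yamamoto's theorem, linearized version), abstract form.** Let `N` dominate every
component (`‖vᵢ‖ ≤ N v`), be subadditive, and be contracted by `I − RA`: `N((I − RA)v) ≤ g·N v`,
`g < 1` (for `N = ‖·‖_p`, `p ∈ {1, 2, ∞}`, this is `‖I − RA‖_p ≤ g < 1`). Then `A` is nonsingular and,
COMPONENTWISE, `|A⁻¹b − x̃|ᵢ ≤ |R(b − Ax̃)|ᵢ + (N(R(b − Ax̃)) / (1 − g)) (|I − RA| e)ᵢ` — (4.4).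
[cite: OgitaOishi2009, Theorem 4.3 (4.4)] [cite: Yamamoto1984] -/
theorem yamamoto (hN : ∀ v i, ‖v i‖ ≤ N v) (hadd : ∀ v w, N (v + w) ≤ N v + N w)
    (hG : ∀ v, N ((1 - R * A) *ᵥ v) ≤ g * N v) (hg : g < 1) (b xt : n → K) (i : n) :
    ‖(A⁻¹ *ᵥ b - xt) i‖ ≤ ‖(R *ᵥ (b - A *ᵥ xt)) i‖
      + N (R *ᵥ (b - A *ᵥ xt)) / (1 - g) * ∑ j, ‖(1 - R * A) i j‖ := by
  have hA := (isUnit_det_of_contraction hN hG hg).1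
  set d := A⁻¹ *ᵥ b - xt with hd
  have hNd : N d ≤ N (R *ᵥ (b - A *ᵥ xt)) / (1 - g) := size_inv_mulVec_sub_le hN hadd hG hg b xt
  have hGd : ‖((1 - R * A) *ᵥ d) i‖ ≤ (∑ j, ‖(1 - R * A) i j‖) * (N (R *ᵥ (b - A *ᵥ xt)) / (1 - g)) :=
    norm_mulVec_apply_le_rowSum_mul _ (fun j => (hN d j).trans hNd) i
  calc ‖d i‖ = ‖(R *ᵥ (b - A *ᵥ xt)) i + ((1 - R * A) *ᵥ d) i‖ := by
        rw [← Pi.add_apply, ← inv_mulVec_sub_eq hA]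
    _ ≤ ‖(R *ᵥ (b - A *ᵥ xt)) i‖ + ‖((1 - R * A) *ᵥ d) i‖ := norm_add_le _ _
    _ ≤ _ := by rw [mul_comm (N _ / _)]; exact add_le_add le_rfl hGd

/-- **THEOREM 4.5 (Ogita–Oishi–Ushiro), abstract form.** If `A` is nonsingular and `N` dominates every
component with `N(A⁻¹v) ≤ τ·N v` (for `N = ‖·‖_p`: `‖A⁻¹‖_p ≤ τ`), then for every `x̃` and every
correction `ỹ`, componentwise `|A⁻¹b − x̃|ᵢ ≤ |ỹ|ᵢ + τ·N(b − A(x̃ + ỹ))` — (4.10).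
[cite: OgitaOishi2009, Theorem 4.5 (4.10)] [cite: OgitaOishiUshiro2003] -/
theorem oou_componentwise {A : Matrix n n K} (hA : IsUnit A.det) {N : (n → K) → ℝ} {τ : ℝ}
    (hN : ∀ v i, ‖v i‖ ≤ N v) (hAinv : ∀ v, N (A⁻¹ *ᵥ v) ≤ τ * N v) (b xt yt : n → K) (i : n) :
    ‖(A⁻¹ *ᵥ b - xt) i‖ ≤ ‖yt i‖ + τ * N (b - A *ᵥ (xt + yt)) := by
  have hid : A⁻¹ *ᵥ b - xt = yt + A⁻¹ *ᵥ (b - A *ᵥ (xt + yt)) := by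
    rw [mulVec_sub, mulVec_mulVec, nonsing_inv_mul A hA, one_mulVec]
    abel
  calc ‖(A⁻¹ *ᵥ b - xt) i‖ = ‖yt i + (A⁻¹ *ᵥ (b - A *ᵥ (xt + yt))) i‖ := by
        rw [hid, Pi.add_apply]
    _ ≤ ‖yt i‖ + ‖(A⁻¹ *ᵥ (b - A *ᵥ (xt + yt))) i‖ := norm_add_le _ _
    _ ≤ ‖yt i‖ + N (A⁻¹ *ᵥ (b - A *ᵥ (xt + yt))) := add_le_add le_rfl (hN _ i)
    _ ≤ ‖yt i‖ + τ * N (b - A *ᵥ (xt + yt)) := add_le_add le_rfl (hAinv _)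

end Abstract

/-! ### The instances `p = ∞` (sup norm / max row sum) and `p = 1` (sum norm / max column sum) -/

section Instances

variable {A R : Matrix n n K} {g : ℝ}

/-- `p = ∞`: `‖I − RA‖_∞ ≤ g < 1` ⟹ `A` and `R` nonsingular. [cite: OgitaOishi2009, Theorem 4.3] [cite: Yamamoto1984] -/
theorem isUnit_det_of_linfty_norm_lt (hg : ‖1 - R * A‖ ≤ g) (hg1 : g < 1) :
    IsUnit A.det ∧ IsUnit R.det :=
  isUnit_det_of_contraction (N := fun v => ‖v‖) (fun v i => norm_le_pi_norm v i)
    (fun v => (linfty_opNorm_mulVec _ v).trans (mul_le_mul_of_nonneg_right hg (norm_nonneg _))) hg1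

/-- **THEOREM 4.3 for `p = ∞`**: if `‖I − RA‖_∞ ≤ g < 1` then `A` is nonsingular and for all `b, x̃, i`,
`|A⁻¹b − x̃|ᵢ ≤ |R(b − Ax̃)|ᵢ + (‖R(b − Ax̃)‖_∞ / (1 − g)) (|I − RA| e)ᵢ`.
[cite: OgitaOishi2009, Theorem 4.3 (4.4)] [cite: Yamamoto1984] -/
theorem yamamoto_linfty (hg : ‖1 - R * A‖ ≤ g) (hg1 : g < 1) (b xt : n → K) (i : n) :
    ‖(A⁻¹ *ᵥ b - xt) i‖ ≤ ‖(R *ᵥ (b - A *ᵥ xt)) i‖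
      + ‖R *ᵥ (b - A *ᵥ xt)‖ / (1 - g) * ∑ j, ‖(1 - R * A) i j‖ :=
  yamamoto (N := fun v => ‖v‖) (fun v i => norm_le_pi_norm v i) (fun v w => norm_add_le v w)
    (fun v => (linfty_opNorm_mulVec _ v).trans (mul_le_mul_of_nonneg_right hg (norm_nonneg _)))
    hg1 b xt i

/-- `p = ∞`, norm form: `‖I − RA‖_∞ ≤ g < 1 ⟹ ‖A⁻¹b − x̃‖_∞ ≤ ‖R(b − Ax̃)‖_∞ / (1 − g)`.
[cite: OgitaOishi2009, Theorem 4.3 and Theorem 4.1] -/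
theorem linfty_norm_inv_mulVec_sub_le (hg : ‖1 - R * A‖ ≤ g) (hg1 : g < 1) (b xt : n → K) :
    ‖A⁻¹ *ᵥ b - xt‖ ≤ ‖R *ᵥ (b - A *ᵥ xt)‖ / (1 - g) :=
  size_inv_mulVec_sub_le (N := fun v => ‖v‖) (fun v i => norm_le_pi_norm v i)
    (fun v w => norm_add_le v w)
    (fun v => (linfty_opNorm_mulVec _ v).trans (mul_le_mul_of_nonneg_right hg (norm_nonneg _)))
    hg1 b xt

omit [DecidableEq n] in
/-- the `ℓ1` size of `Mv` is at most the largest absolute COLUMN sum of `M` times the `ℓ1` size of `v`.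
[cite: OgitaOishi2009, Theorem 4.3 (case p = 1)] -/
theorem sum_norm_mulVec_le_of_colSum_le (M : Matrix n n K) {c : ℝ} (hc : ∀ j, ∑ i, ‖M i j‖ ≤ c)
    (v : n → K) : ∑ i, ‖(M *ᵥ v) i‖ ≤ c * ∑ j, ‖v j‖ := by
  calc ∑ i, ‖(M *ᵥ v) i‖ = ∑ i, ‖∑ j, M i j * v j‖ := by simp only [Matrix.mulVec, dotProduct]
    _ ≤ ∑ i, ∑ j, ‖M i j‖ * ‖v j‖ :=
        sum_le_sum fun i _ => (norm_sum_le _ _).trans (le_of_eq (by simp_rw [norm_mul]))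
    _ = ∑ j, (∑ i, ‖M i j‖) * ‖v j‖ := by rw [Finset.sum_comm]; simp_rw [Finset.sum_mul]
    _ ≤ ∑ j, c * ‖v j‖ := sum_le_sum fun j _ => mul_le_mul_of_nonneg_right (hc j) (norm_nonneg _)
    _ = c * ∑ j, ‖v j‖ := by rw [Finset.mul_sum]

/-- **THEOREM 4.3 for `p = 1`**: if every absolute column sum of `I − RA` is `≤ g < 1`
(`‖I − RA‖₁ ≤ g`) then `A` is nonsingular and for all `b, x̃, i`,
`|A⁻¹b − x̃|ᵢ ≤ |R(b − Ax̃)|ᵢ + (‖R(b − Ax̃)‖₁ / (1 − g)) (|I − RA| e)ᵢ`, `‖v‖₁ = Σⱼ |vⱼ|`.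
[cite: OgitaOishi2009, Theorem 4.3 (4.4)] [cite: Yamamoto1984] -/
theorem yamamoto_l1 (hg : ∀ j, ∑ i, ‖(1 - R * A) i j‖ ≤ g) (hg1 : g < 1) (b xt : n → K) (i : n) :
    ‖(A⁻¹ *ᵥ b - xt) i‖ ≤ ‖(R *ᵥ (b - A *ᵥ xt)) i‖
      + (∑ j, ‖(R *ᵥ (b - A *ᵥ xt)) j‖) / (1 - g) * ∑ j, ‖(1 - R * A) i j‖ :=
  yamamoto (N := fun v => ∑ j, ‖v j‖)
    (fun v i => single_le_sum (f := fun j => ‖v j‖) (fun j _ => norm_nonneg _) (mem_univ i))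
    (fun v w => by
      rw [← sum_add_distrib]; exact sum_le_sum fun j _ => norm_add_le _ _)
    (fun v => sum_norm_mulVec_le_of_colSum_le _ hg v) hg1 b xt i

/-- **THEOREM 4.5 for `p = ∞`**: if `A` is nonsingular with `‖A⁻¹‖_∞ ≤ τ` then for every `x̃` and every
correction `ỹ` (typically an approximate solution of `Ay = b − Ax̃`),
`|A⁻¹b − x̃|ᵢ ≤ |ỹ|ᵢ + τ ‖b − A(x̃ + ỹ)‖_∞`. [cite: OgitaOishi2009, Theorem 4.5 (4.10)] [cite: OgitaOishiUshiro2003] -/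
theorem oou_componentwise_linfty {A : Matrix n n K} (hA : IsUnit A.det) {τ : ℝ} (hτ : ‖A⁻¹‖ ≤ τ)
    (b xt yt : n → K) (i : n) :
    ‖(A⁻¹ *ᵥ b - xt) i‖ ≤ ‖yt i‖ + τ * ‖b - A *ᵥ (xt + yt)‖ :=
  oou_componentwise hA (N := fun v => ‖v‖) (fun v i => norm_le_pi_norm v i)
    (fun v => (linfty_opNorm_mulVec _ v).trans (mul_le_mul_of_nonneg_right hτ (norm_nonneg _)))
    b xt yt i

end Instances

/-! ### `‖A⁻¹‖_∞` for monotone matrices (Theorem 5.1) and H-matrices (Corollary 5.2) -/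

section Monotone

omit [DecidableEq n] in
/-- `(M e)ᵢ = Σⱼ Mᵢⱼ` for the all-ones vector `e = 1`. [cite: OgitaOishi2009, Theorem 5.1 (proof)] -/
theorem mulVec_one_apply {L : Type*} [NonAssocSemiring L] (M : Matrix n n L) (i : n) :
    (M *ᵥ 1) i = ∑ j, M i j := by
  simp only [Matrix.mulVec, dotProduct, Pi.one_apply, mul_one]

/-- **THEOREM 5.1 (Ogita–Oishi–Ushiro): `‖A⁻¹‖_∞` of a monotone matrix from ONE approximate solve.**
Let `A` be monotone (`A` nonsingular, `A⁻¹ ≥ O` entrywise) and `ỹ` any vector (an approximate solution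
of `Ay = e`), `s := e − Aỹ`. If `‖s‖_∞ ≤ σ < 1` then `‖A⁻¹‖_∞ ≤ ‖ỹ‖_∞ / (1 − σ)` — (5.1) with
`σ = ‖s‖_∞`. Proof: `A⁻¹e = ỹ + A⁻¹s` and the row sums of `A⁻¹ ≥ O` are its absolute row sums.
[cite: OgitaOishi2009, Theorem 5.1 (5.1)] [cite: OgitaOishiUshiro2001] -/
theorem linfty_norm_inv_le_of_inv_nonneg {A : Matrix n n ℝ} (hA : IsUnit A.det)
    (hpos : ∀ i j, 0 ≤ A⁻¹ i j) (yt : n → ℝ) {σ : ℝ} (hs : ‖1 - A *ᵥ yt‖ ≤ σ) (hσ : σ < 1) :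
    ‖A⁻¹‖ ≤ ‖yt‖ / (1 - σ) := by
  set s := 1 - A *ᵥ yt with hs_def
  -- `A⁻¹ e = ỹ + A⁻¹ s`
  have hid : A⁻¹ *ᵥ (1 : n → ℝ) = yt + A⁻¹ *ᵥ s := by
    rw [hs_def, mulVec_sub, mulVec_mulVec, nonsing_inv_mul A hA, one_mulVec]; abel
  have hσ0 : 0 ≤ σ := (norm_nonneg _).trans hs
  refine linfty_opNorm_le_of_row_sum_le (div_nonneg (norm_nonneg _) (sub_pos.mpr hσ).le) fun i => ?_
  -- row `i`: `rᵢ := Σⱼ (A⁻¹)ᵢⱼ = ỹᵢ + (A⁻¹ s)ᵢ ≤ ‖ỹ‖ + rᵢ σ`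
  have hrow : ∑ j, ‖A⁻¹ i j‖ = ∑ j, A⁻¹ i j :=
    sum_congr rfl fun j _ => Real.norm_of_nonneg (hpos i j)
  have hr0 : 0 ≤ ∑ j, A⁻¹ i j := sum_nonneg fun j _ => hpos i j
  have h1 : ∑ j, A⁻¹ i j = yt i + (A⁻¹ *ᵥ s) i := by
    rw [← mulVec_one_apply, hid, Pi.add_apply]
  have h2 : (A⁻¹ *ᵥ s) i ≤ (∑ j, A⁻¹ i j) * σ := by
    have hsj : ∀ j, s j ≤ σ := fun j =>
      (le_abs_self _).trans ((Real.norm_eq_abs _ ▸ norm_le_pi_norm s j).trans hs)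
    calc (A⁻¹ *ᵥ s) i = ∑ j, A⁻¹ i j * s j := by simp only [Matrix.mulVec, dotProduct]
      _ ≤ ∑ j, A⁻¹ i j * σ := sum_le_sum fun j _ => mul_le_mul_of_nonneg_left (hsj j) (hpos i j)
      _ = (∑ j, A⁻¹ i j) * σ := by rw [Finset.sum_mul]
  have h3 : yt i ≤ ‖yt‖ := (le_abs_self _).trans (Real.norm_eq_abs _ ▸ norm_le_pi_norm yt i)
  rw [hrow, le_div_iff₀ (sub_pos.mpr hσ)]
  nlinarith

/-- **THEOREM 5.1, M-matrix case**: a Z-matrix `A` (off-diagonal entries `≤ 0`) with a positive vector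
`u`, `Au ≫ 0`, is monotone (nonsingular, `A⁻¹ ≥ O` — the landed `IsZMatrix.inv_nonneg_of_semipositive`);
hence `‖e − Aỹ‖_∞ ≤ σ < 1 ⟹ ‖A⁻¹‖_∞ ≤ ‖ỹ‖_∞ / (1 − σ)`.
[cite: OgitaOishi2009, Theorem 5.1 (5.1) and §5.1] [cite: OgitaOishiUshiro2001] -/
theorem linfty_norm_inv_le_of_isZMatrix {A : Matrix n n ℝ} (hZ : IsZMatrix A) {u : n → ℝ}
    (hu : ∀ i, 0 < u i) (hAu : ∀ i, 0 < (A *ᵥ u) i) (yt : n → ℝ) {σ : ℝ}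
    (hs : ‖1 - A *ᵥ yt‖ ≤ σ) (hσ : σ < 1) : IsUnit A.det ∧ ‖A⁻¹‖ ≤ ‖yt‖ / (1 - σ) :=
  ⟨hZ.isUnit_det_of_semipositive hu hAu,
    linfty_norm_inv_le_of_inv_nonneg (hZ.isUnit_det_of_semipositive hu hAu)
      (hZ.inv_nonneg_of_semipositive hu hAu) yt hs hσ⟩

/-- If `ỹ ≫ 0` itself and `‖e − Aỹ‖_∞ ≤ σ < 1` for a Z-matrix `A`, then `ỹ` IS the positivity witness
(`Aỹ = e − s ≥ (1 − σ)e ≫ 0`): `A` is a nonsingular M-matrix and `‖A⁻¹‖_∞ ≤ ‖ỹ‖_∞ / (1 − σ)`.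
[cite: OgitaOishi2009, Theorem 5.1 (5.1) and §5.1 (p. 185)] -/
theorem linfty_norm_inv_le_of_isZMatrix_of_pos {A : Matrix n n ℝ} (hZ : IsZMatrix A) {yt : n → ℝ}
    (hy : ∀ i, 0 < yt i) {σ : ℝ} (hs : ‖1 - A *ᵥ yt‖ ≤ σ) (hσ : σ < 1) :
    IsUnit A.det ∧ ‖A⁻¹‖ ≤ ‖yt‖ / (1 - σ) := by
  have hAu : ∀ i, 0 < (A *ᵥ yt) i := fun i => by
    have h1 : |(1 - A *ᵥ yt) i| ≤ σ := by
      have h0 := (norm_le_pi_norm (1 - A *ᵥ yt) i).trans hs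
      rwa [Real.norm_eq_abs] at h0
    rw [Pi.sub_apply, Pi.one_apply] at h1
    have := (abs_le.mp h1).2
    linarith
  exact linfty_norm_inv_le_of_isZMatrix hZ hy hAu yt hs hσ

end Monotone

section HMatrix

/-- **COROLLARY 5.2: `‖A⁻¹‖_∞` of an H-matrix from one approximate solve with the comparison matrix.**
Let `A` (entries in a normed field) be an H-matrix — `u ≫ 0` with `𝓜(A)u ≫ 0` — and `z̃` any real
vector, `t := e − 𝓜(A)z̃`. If `‖t‖_∞ ≤ σ < 1` then `A` is nonsingular and
`‖A⁻¹‖_∞ ≤ ‖z̃‖_∞ / (1 − σ)` — (5.2): Theorem 5.1 for the monotone matrix `𝓜(A)` and Ostrowski's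
`‖A⁻¹‖_∞ ≤ ‖𝓜(A)⁻¹‖_∞` (2.1). [cite: OgitaOishi2009, Corollary 5.2 (5.2), (2.1) and Lemma 2.6] -/
theorem linfty_norm_inv_le_of_comparison_residual {A : Matrix n n K} {u : n → ℝ}
    (hu : ∀ i, 0 < u i) (hMu : ∀ i, 0 < (comparisonMatrix A *ᵥ u) i) (zt : n → ℝ) {σ : ℝ}
    (ht : ‖1 - comparisonMatrix A *ᵥ zt‖ ≤ σ) (hσ : σ < 1) :
    IsUnit A.det ∧ ‖A⁻¹‖ ≤ ‖zt‖ / (1 - σ) := by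
  have hO := linfty_norm_inv_le_comparisonInv hu hMu
  have hM := linfty_norm_inv_le_of_isZMatrix (isZMatrix_comparisonMatrix A) hu hMu zt ht hσ
  exact ⟨hO.1, hO.2.trans hM.2⟩

/-- COROLLARY 5.2, self-witnessing form: if `z̃ ≫ 0` and `‖e − 𝓜(A)z̃‖_∞ ≤ σ < 1` then `z̃` itself
proves that `A` is an H-matrix (`𝓜(A)z̃ ≥ (1 − σ)e ≫ 0`), so `A` is nonsingular and
`‖A⁻¹‖_∞ ≤ ‖z̃‖_∞ / (1 − σ)` with no further hypothesis.
[cite: OgitaOishi2009, Corollary 5.2 (5.2), Lemma 2.6 and §5.1 (p. 185)] -/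
theorem linfty_norm_inv_le_of_comparison_residual_of_pos {A : Matrix n n K} {zt : n → ℝ}
    (hz : ∀ i, 0 < zt i) {σ : ℝ} (ht : ‖1 - comparisonMatrix A *ᵥ zt‖ ≤ σ) (hσ : σ < 1) :
    IsUnit A.det ∧ ‖A⁻¹‖ ≤ ‖zt‖ / (1 - σ) := by
  have hMu : ∀ i, 0 < (comparisonMatrix A *ᵥ zt) i := fun i => by
    have h1 : |(1 - comparisonMatrix A *ᵥ zt) i| ≤ σ := by
      have h0 := (norm_le_pi_norm (1 - comparisonMatrix A *ᵥ zt) i).trans ht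
      rwa [Real.norm_eq_abs] at h0
    rw [Pi.sub_apply, Pi.one_apply] at h1
    have := (abs_le.mp h1).2
    linarith
  exact linfty_norm_inv_le_of_comparison_residual hz hMu zt ht hσ

end HMatrix

/-! ### Strictly diagonally dominant matrices: `R = D⁻¹` already gives `‖I − RA‖_∞ < 1` (§5, p. 184) -/

section DiagDominant

/-- entries of `I − D⁻¹A`, `D = diag(a₁₁, …, aₙₙ)`: zero on the diagonal (when `aᵢᵢ ≠ 0`),
`−aᵢⱼ/aᵢᵢ` off it. [cite: OgitaOishi2009, §5 (p. 184)] -/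
theorem one_sub_diagInv_mul_apply (A : Matrix n n K) (i j : n) :
    (1 - diagonal (fun k => (A k k)⁻¹) * A) i j = (if i = j then 1 else 0) - (A i i)⁻¹ * A i j := by
  simp [diagonal_mul, Matrix.one_apply]

/-- **§5 (p. 184): for a strictly (row) diagonally dominant `A` the diagonal preconditioner suffices.**
If `Σ_{j≠i} ‖aᵢⱼ‖ < ‖aᵢᵢ‖` for every `i` then, with `R := D⁻¹ = diag(aᵢᵢ⁻¹)`,
`‖I − RA‖_∞ = maxᵢ Σ_{j≠i} ‖aᵢⱼ‖/‖aᵢᵢ‖ < 1` — so Theorem 4.3 applies without computing an approximate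
inverse. [cite: OgitaOishi2009, §5 (p. 184)] -/
theorem linfty_norm_one_sub_diagInv_mul_lt_one {A : Matrix n n K}
    (hdd : ∀ i, ∑ j ∈ univ.erase i, ‖A i j‖ < ‖A i i‖) :
    ‖1 - diagonal (fun k => (A k k)⁻¹) * A‖ < 1 := by
  set M := 1 - diagonal (fun k => (A k k)⁻¹) * A with hM
  -- each absolute row sum of `M` is `< 1`
  have hrow : ∀ i, ∑ j, ‖M i j‖ < 1 := fun i => by
    have hii : 0 < ‖A i i‖ := lt_of_le_of_lt (sum_nonneg fun j _ => norm_nonneg _) (hdd i)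
    have hne : A i i ≠ 0 := norm_pos_iff.mp hii
    have hdiag : ‖M i i‖ = 0 := by
      rw [hM, one_sub_diagInv_mul_apply, if_pos rfl, inv_mul_cancel₀ hne, sub_self, norm_zero]
    have hoff : ∀ j ∈ univ.erase i, ‖M i j‖ = ‖A i j‖ / ‖A i i‖ := fun j hj => by
      have hij : i ≠ j := (ne_of_mem_erase hj).symm
      rw [hM, one_sub_diagInv_mul_apply, if_neg hij, zero_sub, norm_neg, norm_mul, norm_inv,
        div_eq_inv_mul]
    rw [← add_sum_erase _ _ (mem_univ i), hdiag, zero_add, sum_congr rfl hoff, ← sum_div,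
      div_lt_one hii]
    exact hdd i
  -- hence the max row sum is `< 1`
  rw [linfty_opNorm_def]
  have h1 : (univ.sup fun i => ∑ j, ‖M i j‖₊) < 1 := by
    refine (Finset.sup_lt_iff zero_lt_one).mpr fun i _ => ?_
    rw [← NNReal.coe_lt_coe]; push_cast; exact hrow i
  exact_mod_cast h1

/-- Consequently a strictly diagonally dominant matrix is nonsingular and Yamamoto's bound (4.4) holds
with `R = D⁻¹` and `p = ∞`:
`|A⁻¹b − x̃|ᵢ ≤ |D⁻¹(b − Ax̃)|ᵢ + (‖D⁻¹(b − Ax̃)‖_∞/(1 − ‖I − D⁻¹A‖_∞)) (|I − D⁻¹A| e)ᵢ`.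
[cite: OgitaOishi2009, §5 (p. 184) with Theorem 4.3 (4.4)] -/
theorem yamamoto_diagDominant {A : Matrix n n K} (hdd : ∀ i, ∑ j ∈ univ.erase i, ‖A i j‖ < ‖A i i‖)
    (b xt : n → K) (i : n) :
    IsUnit A.det ∧
      ‖(A⁻¹ *ᵥ b - xt) i‖ ≤ ‖(diagonal (fun k => (A k k)⁻¹) *ᵥ (b - A *ᵥ xt)) i‖
        + ‖diagonal (fun k => (A k k)⁻¹) *ᵥ (b - A *ᵥ xt)‖
            / (1 - ‖1 - diagonal (fun k => (A k k)⁻¹) * A‖)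
          * ∑ j, ‖(1 - diagonal (fun k => (A k k)⁻¹) * A) i j‖ :=
  ⟨(isUnit_det_of_linfty_norm_lt le_rfl (linfty_norm_one_sub_diagInv_mul_lt_one hdd)).1,
    yamamoto_linfty le_rfl (linfty_norm_one_sub_diagInv_mul_lt_one hdd) b xt i⟩

end DiagDominant

/-! ### Sanity: the hypotheses are satisfiable (a `1 × 1` instance over `ℝ`) -/

section Sanity

/-- `A = R = (1)`: `I − RA = 0`, so `g = 0` works and (4.4) reads `|b − x̃| ≤ |b − x̃| + 0`. -/
example (b xt : Fin 1 → ℝ) (i : Fin 1) :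
    ‖((1 : Matrix (Fin 1) (Fin 1) ℝ)⁻¹ *ᵥ b - xt) i‖
      ≤ ‖((1 : Matrix (Fin 1) (Fin 1) ℝ) *ᵥ (b - (1 : Matrix (Fin 1) (Fin 1) ℝ) *ᵥ xt)) i‖
        + ‖(1 : Matrix (Fin 1) (Fin 1) ℝ) *ᵥ (b - (1 : Matrix (Fin 1) (Fin 1) ℝ) *ᵥ xt)‖ / (1 - 0)
          * ∑ j, ‖((1 : Matrix (Fin 1) (Fin 1) ℝ)
              - (1 : Matrix (Fin 1) (Fin 1) ℝ) * (1 : Matrix (Fin 1) (Fin 1) ℝ)) i j‖ :=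
  yamamoto_linfty (A := 1) (R := 1) (g := 0) (by simp) zero_lt_one b xt i

/-- Theorem 5.1 for `A = (1)`, `ỹ = e`: `s = 0`, bound `‖A⁻¹‖ ≤ ‖e‖/(1 − 0)`. -/
example : ‖(1 : Matrix (Fin 1) (Fin 1) ℝ)⁻¹‖ ≤ ‖(1 : Fin 1 → ℝ)‖ / (1 - 0) :=
  linfty_norm_inv_le_of_inv_nonneg (A := 1) (by simp) (fun i j => by
    rw [inv_one, Matrix.one_apply]; split_ifs <;> norm_num) 1 (by simp) zero_lt_one

end Sanity

end Literature.Analysis.Matrix.ComponentwiseVerification
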